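import Summits.BirchSwinnertonDyer.BirchSwinnertonDyer.Theses.SemiOrdinaryEisensteinDescent
import Summits.BirchSwinnertonDyer.BirchSwinnertonDyer.Theorems.SemiOrdinaryEisensteinDescentEisensteinKernelAtThreeTowerFreeOddOfValueAtOne
import Summits.BirchSwinnertonDyer.BirchSwinnertonDyer.Theorems.UniversalToricDescentWildSplitControlAtThreeOfPoitouTate
import HarnessLib

/-!
# Route `SemiOrdinaryEisensteinDescent`, crux #2 of record `WildSplitEisensteinValueAtOneV` (stmt-BirchSwinnertonDyer-26610, `E_𝟙^V`):
# INDEX CURRENCY — modulo print (PUB, Hsieh ∧ BDP ∧ LZZ, Poitou–Tate), `E_𝟙^V` ⟺ the Gross–Zagier–BSD₃ lower bound on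
# `#Ш(E/K)` at Friedberg–Hoffstein data, `2·ord₃[E(K):ℤP] ≤ ord₃#Ш(E/K) + 2·ord₃∏c_q + 2·ord₃c` (`I_FH`, no Iwasawa theory)
# (cell `pub/bsd-wall`, width seat `bsd-wall-soed-p1-w2` g12, `--supports stmt-BirchSwinnertonDyer-26610`, helper)

WHY. Since act G′-V (SOED revs 20–25, 2026-08-28) the route's Eisenstein crux is the value-at-𝟙 shadow `E_𝟙^V`
(`WildSplitEisensteinValueAtOneV`): at every Heegner datum of the onto wild r₁ cell with `L(E^(d_K),1) ≠ 0`, `P = y_K` non-torsion,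
`d_K` odd, every anticyclotomic frame with `X_(∅,0)` torsion at `𝔭′` and a unit value display `𝓛(𝟙) = u·(log_ω P/c)²`, every
characteristic generator has `‖f(𝟙)‖₃ ≤ ‖𝓛(𝟙)‖₃`. Its statement still speaks Iwasawa theory (`X_(∅,0)`, the BDP/LZZ function `𝓛`),
but NO Λ-adic content is left in it: this file proves that, modulo the route's PRINT binders, `E_𝟙^V` is EQUIVALENT to the plain
index inequality `I_FH` (displayed: `SchneiderFree.IndexLowerBoundLeAt W 3 K P (v₃ c)` = JSW17 (eq:shalowerK-1) with the Manin
slack, at every such datum) — the «≥ half of the 3-part of #Ш(E/K)» in Gross–Zagier currency: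

* §1 `indexLowerBoundFH_of_valueAtOneV_of_print_of_poitouTate` —
  `PublishedInputsWildThree → WildSplitEisensteinValueAtOneV → WildSplitPrintedInputsAtThree → PoitouTateSelmerStructureDualityFact → I_FH`:
  kernel⁗'s middle (p606694 §1 / p609065 §1): at the datum pick a frame `(κ, γ, 𝔭, 𝔭′)`, the `R₀`-frame at `𝔭` from print (24475 ✓)
  with its unit value forced by LZZ, the `≤`-control + CTL₀ at `𝔭′` from PT1; `E_𝟙^V` read through
  `Tight.imcLowerLe_iff_forall_norm_constantCoeff_le` is T-B6-1 at slack `v₃(c)`; the `≤`-link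
  (`AdditiveRankOneControlLe.indexLowerBoundLeAt_of_imcLowerLe_of_controlLe_zero`) gives `I_FH`.
* §2 `valueAtOneV_of_indexLowerBoundFH_of_poitouTate` —
  `PublishedInputsWildThree → I_FH → PoitouTateSelmerStructureDualityFact → PT2 → WildSplitEisensteinValueAtOneV`:
  w2 g4's Tight §3 tail: `I_FH` at the datum + the control EQUALITY at `𝔭′` (crux C from PT1 ∧ PT2 + tree theorems, UTD's
  `UniversalToricDescentControl.wildSplitControlAtThree_of_poitouTate`) give T-B6-1 at slack `v₃(c)` (K1 door
  `SchneiderFreeAdditiveX3.additiveIMCLowerBDPOnTreeLeAt_of_indexLowerBoundLeAt_of_control`); the value display moved to `𝔭′`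
  (rank one) turns it into the norm inequality (`Tight.norm_constantCoeff_le_of_imcLowerLe`).
* §3 `valueAtOneV_iff_indexLowerBoundFH` — modulo {PUB, package, PT1, PT2}: `E_𝟙^V ↔ I_FH`.

READING (for the pen / births desk / the next lead; nothing is re-typed here): the E-lineage's crux can be attacked and LINED in
index currency — ONE research stub `I_FH` (STEP L♯ at FH data on the O6 cell; the tree's `SchneiderFree.AdditiveStepLInputManinAt`
is the same inequality on the ORDINARY additive locus N10, which excludes O6) + print stubs PT1/PT2/PUB by name, composition = §2.
The walls W1–W3 (`Cruxes/WildSplitEisensteinInclusionAtThree/Lines/birth-dead*.md`) concern ENGINES for this inequality, not its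
currency; no engine is claimed here.

HONEST FRAMING: theorems only, every conjectural statement is a HYPOTHESIS; nothing is asserted about any curve; closes nothing;
BSD₃ is proved for no curve. No definition, no named fact, no `sorry`.

References: [JetchevSkinnerWan2017] Thm. 3.3.1, Prop. 3.3.4, §7.4.1 (eq:shalowerK-1) (arXiv:1512.06894 pp. 11–13, 30);
[GrossZagier1986] I.(6.3), V §2; [Kolyvagin1990] Thm. A; [MilneADT2006] I Thm. 4.10, Thm. 2.8; [Castella2018] Thm. 2.3, §5;
[FriedbergHoffstein1995] Thm. B; [LiuZhangZhang2018] Thm 1.5.1/1.5.3; [Hsieh2014] Thm. A; [BertoliniDarmonPrasanna2013] Thm. 5.13;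
[Brink2007] Thm. 2, Cor. 1; [Serre1967GroupesPDivisibles] §5 Prop. 8.
-/

noncomputable section

open scoped Classical NumberField

set_option linter.dupNamespace false -- `Summit.BirchSwinnertonDyer.BirchSwinnertonDyer.Theorems.…` (summit = sub, D-0017)
set_option autoImplicit false

namespace Summit.BirchSwinnertonDyer.BirchSwinnertonDyer.Theorems.WildSplitEisensteinValueAtOneVIndexCurrency

open WeierstrassCurve NumberField IsDedekindDomain Field PowerSeries
  Literature.NumberTheory.EllipticCurves
  Literature.NumberTheory.EllipticCurves.ModularForms
  Literature.NumberTheory.EllipticCurves.Rank1Residual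
  Literature.NumberTheory.EllipticCurves.KrizLi2019
  Literature.NumberTheory.GaloisCohomology
  Summit.BirchSwinnertonDyer.Rank1Residual
  Summit.BirchSwinnertonDyer.Rank1Residual.Additive
  Summit.BirchSwinnertonDyer.Rank1Residual.X11b
  Summit.BirchSwinnertonDyer.Rank1Residual.X11b.AcSelmer
  Summit.BirchSwinnertonDyer.Rank1Residual.X11b.Halves
  Summit.BirchSwinnertonDyer.BirchSwinnertonDyer.Theses.SemiOrdinaryEisensteinDescent
  Summit.BirchSwinnertonDyer.BirchSwinnertonDyer.Theorems

/-! ### §1 `E_𝟙^V ⟹ I_FH` (modulo PUB, the printed package, PT1) -/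

/-- **`PublishedInputsWildThree → WildSplitEisensteinValueAtOneV → WildSplitPrintedInputsAtThree → PoitouTateSelmerStructureDualityFact → I_FH`**:
at every Heegner datum of the onto wild r₁ cell with `L(E^(d_K),1) ≠ 0`, `P = y_K` non-torsion and `d_K` odd,
`2·ord₃[E(K):ℤP] ≤ ord₃#Ш(E/K) + 2·ord₃∏c_q + 2·ord₃c` — from the crux of record `E_𝟙^V` read at ONE frame: an anticyclotomic
generator, split degree-one primes `𝔭 ≠ 𝔭′`, the `R₀`-frame at `𝔭` from print (item 24475 ✓ over Hsieh ∧ BDP) with its unit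
value forced by LZZ, the `≤`-control + CTL₀ at `𝔭′` from Poitou–Tate duality, `E_𝟙^V` ⟹ T-B6-1 at slack `v₃(c)` (w2 g4's
`imcLowerLe_iff_forall_norm_constantCoeff_le`) ⟹ the index inequality by the `≤`-link. Kolyvagin (rank one, `Ш` finite) is a
PUB conjunct. Every crux / fact is an antecedent; nothing asserted about any curve.
[cite: JetchevSkinnerWan2017, Thm. 3.3.1 and §7.4.1 (arXiv:1512.06894 pp. 11, 30)]
[cite: LiuZhangZhang2018, Thm 1.5.1 and Thm 1.5.3 (Duke Math. J. 167 pp. 748–749)] [cite: MilneADT2006, Ch. I, Thm. 4.10(b)] -/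
theorem indexLowerBoundFH_of_valueAtOneV_of_print_of_poitouTate (hF : PublishedInputsWildThree)
    (hE1V : WildSplitEisensteinValueAtOneV) (hW : WildSplitPrintedInputsAtThree)
    (hPT : PoitouTateSelmerStructureDualityFact) :
    ∀ (W : WeierstrassCurve ℚ) [W.IsElliptic] [W.IsGloballyMinimal] (N : ℕ) [NeZero N] (K : Type) [Field K] [NumberField K] (Dt : Literature.NumberTheory.EllipticCurves.ModularForms.ModularParametrizationData W N) (H : Literature.NumberTheory.EllipticCurves.HeegnerDatum N (NumberField.discr K)) (ι : K →+* ℂ) (P : (W.baseChange K).toAffine.Point), Summit.BirchSwinnertonDyer.Rank1Residual.Additive.ClassO6 W 3 → W.HasSurjectiveModNGaloisRep 3 → W.analyticRank = 1 → W.conductorNorm ℤ = N → Literature.NumberTheory.EllipticCurves.IsImaginaryQuadratic K → Literature.NumberTheory.EllipticCurves.SatisfiesHeegnerHypothesis N K → (W.quadraticTwist (NumberField.discr K : ℚ)).entireLFunction 1 ≠ 0 → (WeierstrassCurve.Affine.Point.map ι.toRatAlgHom) P = Literature.NumberTheory.EllipticCurves.ModularForms.heegnerPointComplex Dt H → ¬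 IsOfFinAddOrder P → Odd (NumberField.discr K) → Summit.BirchSwinnertonDyer.BirchSwinnertonDyer.Theorems.SchneiderFree.IndexLowerBoundLeAt W 3 K P (padicValNat 3 Dt.c.natAbs) := by
  intro W _ _ N _ K _ _ Dt H ι P hO6 hsurj hr hN hK hHN hLt hP hnt hodd
  subst hN
  obtain ⟨hH, hB, hLZZ⟩ := hW
  obtain ⟨-, hKo, -, -, -, -, -, -, -, -⟩ := hF
  -- `3 ∣ N(E)` (additive) splits in `K`
  have h3N : 3 ∣ W.conductorNorm ℤ :=
    (W.dvd_conductorNorm_iff_not_hasGoodReductionAtPrime 3).mpr (not_good_of_addv W 3 hO6.2.1)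
  have hsplit : SplitsIn K 3 := hHN 3 Nat.prime_three h3N
  -- Kolyvagin: `rank E(K) = 1`, `Ш(E/K)` finite
  obtain ⟨hrk, hfin⟩ := hKo (W.conductorNorm ℤ) W K hK hHN ⟨Dt, H, ι, hP⟩ hnt
  -- a frame `(κ, γ, 𝔭)` and the other prime `𝔭′ ≠ 𝔭` above `3`
  obtain ⟨κ, γ, -, hκ, hγ, -⟩ := X11b.exists_anticyclotomic_generator_prime (p := 3) hK
  haveI : Fact (κ.IsTopGenerator γ) := ⟨hγ⟩
  obtain ⟨𝔭, h𝔭, he, hf⟩ := X11b.exists_degreeOnePrime_of_splitsIn K 3 hK.1 hsplit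
  obtain ⟨𝔭', hne, h𝔭', he', hf'⟩ := X11b.Three.exists_ne_degreeOne_prime hK.1 h𝔭 he hf
  -- the `R₀`-frame at `(κ, γ, 𝔭)` (odd `d_K`) FROM PRINT (item 24475, CLOSED), its unit value FORCED by LZZ
  obtain ⟨ι', hind, ΩK, Ωp, L, hΩK, hΩp, hBDP⟩ :=
    wildSplitFrameAtThreeOddOfPrint_proof hH hB W (W.conductorNorm ℤ) K Dt hO6 rfl hK hHN hodd κ hκ γ 𝔭 h𝔭
  obtain ⟨u, hval⟩ := EisensteinKernelAtThreeRestrictedOfFrameOdd.exists_unit_hasValueAt_of_frame hLZZ W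
    (W.conductorNorm ℤ) K Dt H ι P hO6 rfl hK hHN hP hnt κ hκ γ 𝔭 h𝔭 he hf ι' hind hΩK hΩp hBDP
  -- the control INEQUALITY at `𝔭′` at slack `0` (CTL₀ included), from Poitou–Tate duality alone
  have hctl : SchneiderFreeControlAtoms.AdditiveControlLeOnTreeAt 3 κ 𝔭' γ (embAt K 3 𝔭' h𝔭' he' hf') 0 P :=
    AdditiveRankOneControlLe.additiveControlLeOnTreeAt_of_poitouTate_of_heegner W 3 (by norm_num) hO6.2.1
      (W.conductorNorm ℤ) K (hPT K) Dt H ι P rfl hK hHN hP hnt (hKo _ W K) κ hκ γ 𝔭' h𝔭' he' hf'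
  obtain ⟨n, hn, hnle⟩ := hctl
  -- the value read through the logarithm at `𝔭′` (rank one)
  have hval' : L.HasValueAt 0 ((((u : unrIntegers 3) : unrIntegers 3) : ℂ_[3]) *
      (algebraMap ℚ_[3] ℂ_[3]
        (logOmega W 3 (embAt K 3 𝔭' h𝔭' he' hf') P / (Dt.c : ℚ_[3]))) ^ 2) :=
    (SchneiderFreeAdditiveX3.hasValueAt_sq_logOmega_embAt_iff_of_rank_one W 3 hK.1 hrk h𝔭 he hf
      h𝔭' he' hf' P _ _ L).mpr hval
  -- `E_𝟙^V` at the frame and at that unit value ⟹ T-B6-1 at slack `v₃(c)`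
  have hc0 : Dt.c ≠ 0 := Dt.maninConstant_ne_zero_holds
  have hlog : logOmega W 3 (embAt K 3 𝔭' h𝔭' he' hf') P ≠ 0 := X11b.R1.logOmega_ne_zero W 3 _ hnt
  have hlow : SchneiderFree.AdditiveIMCLowerBDPOnTreeLeAt 3 κ 𝔭' γ (embAt K 3 𝔭' h𝔭' he' hf')
      (padicValNat 3 Dt.c.natAbs) P :=
    (WildSplitEisensteinInclusionAtThreeTight.imcLowerLe_iff_forall_norm_constantCoeff_le hc0 hlog hn u hval').mpr
      (fun f hfI ↦ hE1V W (W.conductorNorm ℤ) K Dt H ι P hO6 hsurj hr rfl hK hHN hLt hP hnt hodd κ hκ γ 𝔭 h𝔭 he hf 𝔭'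
        h𝔭' hne ι' hind ΩK Ωp L hΩK hΩp hBDP hn.1 u hval f hfI)
  -- the `≤`-link
  exact AdditiveRankOneControlLe.indexLowerBoundLeAt_of_imcLowerLe_of_controlLe_zero rfl hK hHN hfin hlow ⟨n, hn, hnle⟩

/-! ### §2 `I_FH ⟹ E_𝟙^V` (modulo PUB, PT1, PT2) -/

/-- **`PublishedInputsWildThree → I_FH → PoitouTateSelmerStructureDualityFact → PT2 → WildSplitEisensteinValueAtOneV`**: the
index inequality at a Friedberg–Hoffstein datum, together with the control EQUALITY at `𝔭′` — crux C, here a THEOREM from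
Poitou–Tate duality for Selmer structures (PT1) and `Ш¹(T) ≃ Ш²(T^D)^∨` (PT2) with the tree's Euler–Poincaré / `cd ≤ 2` / Brink /
Serre 1967 inputs (UTD's `wildSplitControlAtThree_of_poitouTate`) — gives T-B6-1 at slack `v₃(c)` (K1 door), and the unit value
display moved from `𝔭` to `𝔭′` in rank one turns it into `‖f(𝟙)‖₃ ≤ ‖𝓛(𝟙)‖₃` for every generator (w2 g4's Tight §2). Every
conjectural input is a hypothesis; nothing asserted about any curve.
[cite: JetchevSkinnerWan2017, Thm. 3.3.1, Prop. 3.3.4 and §7.4.1 (arXiv:1512.06894 pp. 11–13, 30)]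
[cite: MilneADT2006, Ch. I, Thm. 4.10 and Thm. 2.8] [cite: GrossZagier1986, Thm. I.(6.3) and V.§2] -/
theorem valueAtOneV_of_indexLowerBoundFH_of_poitouTate (hF : PublishedInputsWildThree)
    (hI : ∀ (W : WeierstrassCurve ℚ) [W.IsElliptic] [W.IsGloballyMinimal] (N : ℕ) [NeZero N] (K : Type) [Field K] [NumberField K] (Dt : Literature.NumberTheory.EllipticCurves.ModularForms.ModularParametrizationData W N) (H : Literature.NumberTheory.EllipticCurves.HeegnerDatum N (NumberField.discr K)) (ι : K →+* ℂ) (P : (W.baseChange K).toAffine.Point), Summit.BirchSwinnertonDyer.Rank1Residual.Additive.ClassO6 W 3 → W.HasSurjectiveModNGaloisRep 3 → W.analyticRank = 1 → W.conductorNorm ℤ = N → Literature.NumberTheory.EllipticCurves.IsImaginaryQuadratic K → Literature.NumberTheory.EllipticCurves.SatisfiesHeegnerHypothesis N K → (W.quadraticTwist (NumberField.discr K : ℚ)).entireLFunction 1 ≠ 0 → (WeierstrassCurve.Affine.Point.map ι.toRatAlgHom) P = Literature.NumberTheory.EllipticCurves.ModularForms.heegnerPointComplex Dt H → ¬ IsOfFinAddOrder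 P → Odd (NumberField.discr K) → Summit.BirchSwinnertonDyer.BirchSwinnertonDyer.Theorems.SchneiderFree.IndexLowerBoundLeAt W 3 K P (padicValNat 3 Dt.c.natAbs))
    (hPT : PoitouTateSelmerStructureDualityFact)
    (hPT2 : ∀ (K : Type) [Field K] [NumberField K], Literature.NumberTheory.GaloisCohomology.poitouTate_sha_tateDual K) :
    WildSplitEisensteinValueAtOneV := by
  intro W _ _ N _ K _ _ Dt H ι P hO6 hsurj hr hN hK hHH hLt hP hnt hodd κ hκ γ _ 𝔭 h𝔭 he hf 𝔭' h𝔭' hne ι'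
    hι' ΩK Ωp L hΩK hΩp hBDP htor u hval f hfI
  obtain ⟨-, hKo, -, -, -, -, -, -, -, -⟩ := hF
  -- `3 ∣ N` splits in `K`; `𝔭′` has degree one
  have h3N : 3 ∣ W.conductorNorm ℤ :=
    (W.dvd_conductorNorm_iff_not_hasGoodReductionAtPrime 3).mpr (not_good_of_addv W 3 hO6.2.1)
  have hpN : 3 ∣ N := hN ▸ h3N
  obtain ⟨he', hf'⟩ :=
    Literature.NumberTheory.EllipticCurves.ramificationIdx_eq_one_and_inertiaDeg_eq_one_of_ncard_primesOver_eq_two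
      3 hK.1 (hHH 3 Nat.prime_three hpN) 𝔭' h𝔭'
  -- the index inequality at the datum
  have hlo : SchneiderFree.IndexLowerBoundLeAt W 3 K P (padicValNat 3 Dt.c.natAbs) :=
    hI W N K Dt H ι P hO6 hsurj hr hN hK hHH hLt hP hnt hodd
  -- Kolyvagin: `rank E(K) = 1`, `Ш(E/K)` finite
  obtain ⟨hrk, hfin⟩ := hKo N W K hK hHH ⟨Dt, H, ι, hP⟩ hnt
  -- the control EQUALITY at `𝔭′` from PT1 ∧ PT2 (crux C as a theorem)
  have hC := UniversalToricDescentControl.wildSplitControlAtThree_of_poitouTate hPT hPT2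
  have hctl : SchneiderFree.AdditiveControlOnTreeAt 3 κ 𝔭' γ (embAt K 3 𝔭' h𝔭' he' hf') P :=
    hC W N K Dt H ι P hO6 hsurj hr hN hK hHH hLt hP hnt (hKo N W K) κ hκ γ 𝔭' h𝔭' he' hf'
  -- T-B6-1 at slack `v₃(c)` at the frame `(κ, 𝔭′, γ)` (K1 door)
  have himc : SchneiderFree.AdditiveIMCLowerBDPOnTreeLeAt 3 κ 𝔭' γ (embAt K 3 𝔭' h𝔭' he' hf')
      (padicValNat 3 Dt.c.natAbs) P :=
    SchneiderFreeAdditiveX3.additiveIMCLowerBDPOnTreeLeAt_of_indexLowerBoundLeAt_of_control hN hK hHH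
      hfin hlo hctl
  -- the value display read at `𝔭′` (rank one), then Tight §2
  have hval' := (SchneiderFreeAdditiveX3.hasValueAt_sq_logOmega_embAt_iff_of_rank_one W 3 hK.1 hrk h𝔭
    he hf h𝔭' he' hf' P _ _ L).mpr hval
  exact WildSplitEisensteinInclusionAtThreeTight.norm_constantCoeff_le_of_imcLowerLe Dt.maninConstant_ne_zero_holds
    (X11b.R1.logOmega_ne_zero W 3 _ hnt) himc u hval' hfI

/-! ### §3 Together -/

/-- **Modulo print (`PublishedInputsWildThree`, the package `WildSplitPrintedInputsAtThree`, Poitou–Tate PT1 and PT2):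
`E_𝟙^V ↔ I_FH`** — SOED's Eisenstein crux of record (26610) is EXACTLY the Gross–Zagier–BSD₃ lower bound on `#Ш(E/K)` at
Friedberg–Hoffstein data, `2·ord₃[E(K):ℤP] ≤ ord₃#Ш(E/K) + 2·ord₃∏c_q + 2·ord₃c`; the Iwasawa-theoretic dressing carries no
further content. Bookkeeping; nothing asserted about any curve. -/
theorem valueAtOneV_iff_indexLowerBoundFH (hF : PublishedInputsWildThree) (hW : WildSplitPrintedInputsAtThree)
    (hPT : PoitouTateSelmerStructureDualityFact)
    (hPT2 : ∀ (K : Type) [Field K] [NumberField K], Literature.NumberTheory.GaloisCohomology.poitouTate_sha_tateDual K) :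
    WildSplitEisensteinValueAtOneV ↔
    (∀ (W : WeierstrassCurve ℚ) [W.IsElliptic] [W.IsGloballyMinimal] (N : ℕ) [NeZero N] (K : Type) [Field K] [NumberField K] (Dt : Literature.NumberTheory.EllipticCurves.ModularForms.ModularParametrizationData W N) (H : Literature.NumberTheory.EllipticCurves.HeegnerDatum N (NumberField.discr K)) (ι : K →+* ℂ) (P : (W.baseChange K).toAffine.Point), Summit.BirchSwinnertonDyer.Rank1Residual.Additive.ClassO6 W 3 → W.HasSurjectiveModNGaloisRep 3 → W.analyticRank = 1 → W.conductorNorm ℤ = N → Literature.NumberTheory.EllipticCurves.IsImaginaryQuadratic K → Literature.NumberTheory.EllipticCurves.SatisfiesHeegnerHypothesis N K → (W.quadraticTwist (NumberField.discr K : ℚ)).entireLFunction 1 ≠ 0 → (WeierstrassCurve.Affine.Point.map ι.toRatAlgHom) P = Literature.NumberTheory.EllipticCurves.ModularForms.heegnerPointComplex Dt H → ¬ IsOfFinAddOrder P → Odd (NumberField.discr K) → Summit.BirchSwinnertonDyer.BirchSwinnertonDyer.Theorems.SchneiderFree.IndexLowerBoundLeAt W 3 K P (padicValNat 3 Dt.c.natAbs))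 :=
  ⟨fun hE1V ↦ indexLowerBoundFH_of_valueAtOneV_of_print_of_poitouTate hF hE1V hW hPT,
    fun hI ↦ valueAtOneV_of_indexLowerBoundFH_of_poitouTate hF hI hPT hPT2⟩

end Summit.BirchSwinnertonDyer.BirchSwinnertonDyer.Theorems.WildSplitEisensteinValueAtOneVIndexCurrency

end
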